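import Summits.QuantumFields.BalabanUV.T4Continuum.Support.NE7EtaRatesD4

/-!
# NE7EtaCovariantJunction — route #1 of the NE7 crux, hardest stub S1∕L7b-background: the ℓ² → sup junction and the discrete
# Landau–Kolmogorov step with GAUGE-COVARIANT hypotheses (covariant first∕second differences of the discrepancy direction `Z` and of
# its dressed curl), so that the re-typed INTERFACE REQUEST NE7→NE3 can be stated in a form INVARIANT under the gauge of run B

Cell `pub-balaban`, rung (B)+1 sub-cell t4, lineage `b2b-balaban-t4-ne7-p1`, generation 22 (CRUX PROVER NE7 #1, ruling e34b3e0c); crux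
skeleton `t4/skeletons/NE7-CRUX-R1.md` v1.6 §3ter.  Sequel of `NE7EtaSupFromEnergy` (p249485), `NE7EtaGradientFromEnergy` (p250680),
`NE7EtaRatesD4` (p251795).  HONEST FRAMING (page 1): FIXED FINITE T⁴, rung (B)+1; NE7, NE3 NOT PRINTED in
[Balaban1984PropagatorsI]–[Balaban1989LargeFieldII] and NOT PROVED here; continuum YM on T⁴ ⇐ BetaPertH ∧ nine spine estimates (0/9 proved);
BetaPertH ⇐ (D1) ∧ (D4) ∧ CAP+tail; G-an2-4 gates asym, D1 and NE2/3/4; NOT infinite volume, NOT mass gap, NOT Clay.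

WHY.  Row NE3's root T-E_w represents the pair as `gaugeAct u UA = vary W Z 1` with `W = rescale L (bavg L UB)` IN THE GAUGE OF `UB`
(only run A is gauge-fixed by the root's `u`).  Under a simultaneous change of gauge `w` of run A's lattice,
`gaugeAct w (vary W Z 1) = vary (gaugeAct w W) Z′ 1` with `Z′ x μ = Ad (w (x + e μ)) (Z x μ)` (right variation ⇒ END-point law), so
`‖Z‖`, the dressed curl's norm and the η-weighted energy norm are INVARIANT, but the PLAIN lattice differences `Z (x + e μ) κ − Z x κ`
of the gen-21∕22 Lipschitz conjuncts (Lip₁)(Lip₂)(Lip₂′) are NOT (they pick up `Ad (w (x + e μ + e κ)) − Ad (w (x + e κ))`).  Asked with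
plain differences, the conjuncts could hold only if the class `𝒞 (k+1)` pins a regular gauge for `W` on every intermediate scale;
asked with COVARIANT differences — (Lip₁ᶜ) `‖Ad (W (x + e κ) μ) (Z (x + e μ) κ) − Z x κ‖ ≤ Λ₁ξ²`, (Lip₂ᶜ)
`‖Ad (W x ρ) (d_W Z)(x + e ρ, π) − (d_W Z)(x, π)‖ ≤ Λ₂ξ³`, (Lip₂′ᶜ) covariant second differences `≤ Λ₂′ξ³` — every conjunct is
gauge-INVARIANT, so NE3 may prove its root in any gauge of `W` it likes, and the conclusions are the COVARIANT (1.13) quantities of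
[Balaban1987RG1] p. 262 (`|∇^ξ_Ũ A′| < α₁` IS a covariant gradient).  THIS FILE supplies the two junction steps in that currency:
 * §1 the ℓ² → sup interpolation needs only Lipschitz bounds on the NORM `x ↦ ‖Z x κ‖` (`norm_dir_le_of_energyNormW_normLip`, periodic
   version, curl twins), and `|‖X‖ − ‖Y‖| ≤ ‖Ad u X − Y‖` for unitary `u` (`abs_norm_sub_norm_le_cov`) turns (Lip₁ᶜ)∕(Lip₂ᶜ) into that;
 * §2 discrete Landau–Kolmogorov for SEQUENCES `g : ℕ → E` (`seq_fwdDiff_le_two_sqrt`: `‖g‖ ≤ M`, second differences `≤ λ₂` ⇒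
   `‖g 1 − g 0‖ ≤ 2√(Mλ₂)`);
 * §3 PARALLEL TRANSPORT ALONG A LATTICE LINE: the holonomy `H j = W_0 W_1 ⋯ W_{j−1}` along the `μ`-line through `x + e κ` conjugates
   `Z (x + j•e μ) κ` back to the base; the transported sequence has forward differences = transported COVARIANT differences and second
   differences = transported covariant second differences (`Ad` is multiplicative and isometric for unitary arguments), whence
   **`norm_covDiff_le_two_sqrt`**: `‖Z‖ ≤ M` everywhere + (Lip₂′ᶜ) `≤ λ₂` ⇒ `‖Ad (W (x + e κ) μ) (Z (x + e μ) κ) − Z x κ‖ ≤ 2√(Mλ₂)`.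
HONEST.  Elementary ([folklore]); hypotheses are displayed bounds on ONE pair; nothing of NE3∕NE7 discharged; 0 def; 0 sorry.
-/

set_option autoImplicit false

open scoped BigOperators Matrix Matrix.Norms.L2Operator
open Finset

namespace Summit.QuantumFields.BalabanUV.T4Continuum.NE7EtaCovariantJunction

open Literature.MathematicalPhysics.QuantumFieldTheory.Balaban1983to89
open B7Prop1Explicit B7Prop2Explicit
open T4AveragingDeficitWall hiding Site Plane Plaq Bond
open T4AveragingDeficitWallBoundary (periodBox IsPeriodicCfg)
open AveragingDeficitPeriodicCounting (IsPeriodicDir)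
open T4AveragingDeficitNonAbelian (Ad_mul Ad_sub)
open AveragingDeficitTransport (norm_Ad_of_unitary)
open AveragingDeficitNearIdentity (Ad_one)
open NE3EnergyWeightedShapes (energyNormW energyNormW_nonneg)
open NE3LocalCrudeWPair (curlSq_le_energyNormW_sq dirSq_le_pow_sq_mul_energyNormW_sq)
open NE7EtaSupFromEnergy (norm_le_of_stepLipschitz_of_sum_sq sum_sq_dir_le sum_sq_curl_le)
open NE7EtaSupFromEnergyTorus (energyNormW_Icc_le_periodBox)

noncomputable section

/-! ## §1 The ℓ² → sup junction with NORM-Lipschitz hypotheses; covariant ⇒ norm-Lipschitz -/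

section NormLip

variable {d : ℕ} {n : Type*} [Fintype n] [DecidableEq n]

/-- **COVARIANT ⇒ NORM-LIPSCHITZ**: for unitary `u`, `|‖X‖ − ‖Y‖| ≤ ‖Ad u X − Y‖` (`Ad u` is an isometry). [folklore] -/
theorem abs_norm_sub_norm_le_cov {u : (Matrix n n ℂ)ˣ} (hu : u ∈ unitaryUnits (Matrix n n ℂ)) (X Y : Matrix n n ℂ) :
    |‖X‖ - ‖Y‖| ≤ ‖Ad u X - Y‖ := by
  rw [← norm_Ad_of_unitary hu X]
  exact abs_norm_sub_norm_le _ _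

/-- **POINTWISE BOUND ON `Z` FROM THE ENERGY NORM, NORM-LIPSCHITZ FORM**: if `x ↦ ‖Z x κ‖` changes by at most `λ ≥ 0` per lattice
step and the cube `Icc y₀ (y₀ + r) ⊆ F` contains `x₀`, then `‖Z x₀ κ‖ ≤ 2d·r·λ + L^k·energyNormW L k W Z F ∕ √((r+1)^d)` (`L ≥ 1`).
(`NE7EtaSupFromEnergy.norm_dir_le_of_energyNormW` asked the VECTOR differences; only the norm's differences are used.) [folklore] -/
theorem norm_dir_le_of_energyNormW_normLip {L : ℕ} (hL : 1 ≤ L) (k : ℕ) (W : Site d → Fin d → (Matrix n n ℂ)ˣ)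
    (Z : Site d → Fin d → Matrix n n ℂ) (κ : Fin d) {lam : ℝ} (hlam : 0 ≤ lam)
    (hlip : ∀ (x : Site d) (μ : Fin d), |‖Z (x + e μ) κ‖ - ‖Z x κ‖| ≤ lam)
    {y₀ x₀ : Site d} {r : ℕ} {F : Finset (Site d)} (hF : Finset.Icc y₀ (y₀ + fun _ => (r : ℤ)) ⊆ F)
    (hx₀ : x₀ ∈ Finset.Icc y₀ (y₀ + fun _ => (r : ℤ))) :
    ‖Z x₀ κ‖ ≤ 2 * d * r * lam + (L : ℝ) ^ k * energyNormW L k W Z F / Real.sqrt (((r : ℝ) + 1) ^ d) := by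
  have hlip' : ∀ (x : Site d) (μ : Fin d), ‖(fun y => ‖Z y κ‖) (x + e μ) - (fun y => ‖Z y κ‖) x‖ ≤ lam := fun x μ => by
    rw [Real.norm_eq_abs]; exact hlip x μ
  have h1 := norm_le_of_stepLipschitz_of_sum_sq (fun y => ‖Z y κ‖) hlam hlip' hF hx₀
  simp only [norm_norm] at h1
  have hE := energyNormW_nonneg L k W Z F
  have hLk : 0 ≤ (L : ℝ) ^ k := pow_nonneg (Nat.cast_nonneg L) k
  have h2 : Real.sqrt (∑ x ∈ F, ‖Z x κ‖ ^ 2) ≤ (L : ℝ) ^ k * energyNormW L k W Z F := by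
    calc Real.sqrt (∑ x ∈ F, ‖Z x κ‖ ^ 2) ≤ Real.sqrt (((L : ℝ) ^ k) ^ 2 * energyNormW L k W Z F ^ 2) :=
          Real.sqrt_le_sqrt (((sum_sq_dir_le Z F κ).trans (dirSq_le_pow_sq_mul_energyNormW_sq hL k W Z F)))
      _ = (L : ℝ) ^ k * energyNormW L k W Z F := by
          rw [← mul_pow, Real.sqrt_sq (mul_nonneg hLk hE)]
  have hpos : 0 < Real.sqrt (((r : ℝ) + 1) ^ d) := Real.sqrt_pos.mpr (by positivity)
  have h3 := div_le_div_of_nonneg_right h2 hpos.le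
  linarith

/-- **POINTWISE BOUND ON THE DRESSED CURL FROM THE ENERGY NORM, NORM-LIPSCHITZ FORM**. [folklore] -/
theorem norm_curl_le_of_energyNormW_normLip (L k : ℕ) (W : Site d → Fin d → (Matrix n n ℂ)ˣ)
    (Z : Site d → Fin d → Matrix n n ℂ) (π : T4AveragingDeficitWall.Plane d) {lam : ℝ} (hlam : 0 ≤ lam)
    (hlip : ∀ (x : Site d) (μ : Fin d), |‖curl W Z (x + e μ, π)‖ - ‖curl W Z (x, π)‖| ≤ lam)
    {y₀ x₀ : Site d} {r : ℕ} {F : Finset (Site d)} (hF : Finset.Icc y₀ (y₀ + fun _ => (r : ℤ)) ⊆ F)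
    (hx₀ : x₀ ∈ Finset.Icc y₀ (y₀ + fun _ => (r : ℤ))) :
    ‖curl W Z (x₀, π)‖ ≤ 2 * d * r * lam + energyNormW L k W Z F / Real.sqrt (((r : ℝ) + 1) ^ d) := by
  have hlip' : ∀ (x : Site d) (μ : Fin d),
      ‖(fun y => ‖curl W Z (y, π)‖) (x + e μ) - (fun y => ‖curl W Z (y, π)‖) x‖ ≤ lam := fun x μ => by
    rw [Real.norm_eq_abs]; exact hlip x μ
  have h1 := norm_le_of_stepLipschitz_of_sum_sq (fun y => ‖curl W Z (y, π)‖) hlam hlip' hF hx₀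
  simp only [norm_norm] at h1
  have hE := energyNormW_nonneg L k W Z F
  have h2 : Real.sqrt (∑ x ∈ F, ‖curl W Z (x, π)‖ ^ 2) ≤ energyNormW L k W Z F := by
    calc Real.sqrt (∑ x ∈ F, ‖curl W Z (x, π)‖ ^ 2) ≤ Real.sqrt (energyNormW L k W Z F ^ 2) :=
          Real.sqrt_le_sqrt ((sum_sq_curl_le W Z F π).trans (curlSq_le_energyNormW_sq L k W Z F))
      _ = energyNormW L k W Z F := Real.sqrt_sq hE
  have hpos : 0 < Real.sqrt (((r : ℝ) + 1) ^ d) := Real.sqrt_pos.mpr (by positivity)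
  have h3 := div_le_div_of_nonneg_right h2 hpos.le
  linarith

/-- The norm-Lipschitz bound on `Z` EVERYWHERE on the period torus (`P`-periodic data; any cube side `r ≤ P − 1`; one period box of energy
on the right). [folklore] -/
theorem norm_dir_le_of_energyNormW_normLip_periodic {L : ℕ} (hL : 1 ≤ L) (k : ℕ) {P : ℕ} (hP : 1 ≤ P)
    {W : Site d → Fin d → (Matrix n n ℂ)ˣ} {Z : Site d → Fin d → Matrix n n ℂ} (hW : IsPeriodicCfg W (P : ℤ))
    (hZ : IsPeriodicDir Z (P : ℤ)) (κ : Fin d) {lam : ℝ} (hlam : 0 ≤ lam)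
    (hlip : ∀ (x : Site d) (μ : Fin d), |‖Z (x + e μ) κ‖ - ‖Z x κ‖| ≤ lam) (x₀ : Site d) {r : ℕ} (hr : r + 1 ≤ P) :
    ‖Z x₀ κ‖ ≤ 2 * d * r * lam + (L : ℝ) ^ k * energyNormW L k W Z (periodBox (d := d) P) / Real.sqrt (((r : ℝ) + 1) ^ d) := by
  have hx₀ : x₀ ∈ Finset.Icc x₀ (x₀ + fun _ => (r : ℤ)) := by
    rw [Finset.mem_Icc]; exact ⟨le_rfl, fun μ => by simp⟩
  have h1 := norm_dir_le_of_energyNormW_normLip hL k W Z κ hlam hlip (subset_refl _) hx₀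
  have h2 := energyNormW_Icc_le_periodBox L k hP hW hZ x₀ hr
  have hpos : 0 < Real.sqrt (((r : ℝ) + 1) ^ d) := Real.sqrt_pos.mpr (by positivity)
  have hLk : 0 ≤ (L : ℝ) ^ k := pow_nonneg (Nat.cast_nonneg L) k
  have h3 := div_le_div_of_nonneg_right (mul_le_mul_of_nonneg_left h2 hLk) hpos.le
  linarith

/-- The norm-Lipschitz bound on the dressed curl EVERYWHERE on the period torus. [folklore] -/
theorem norm_curl_le_of_energyNormW_normLip_periodic (L k : ℕ) {P : ℕ} (hP : 1 ≤ P)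
    {W : Site d → Fin d → (Matrix n n ℂ)ˣ} {Z : Site d → Fin d → Matrix n n ℂ} (hW : IsPeriodicCfg W (P : ℤ))
    (hZ : IsPeriodicDir Z (P : ℤ)) (π : T4AveragingDeficitWall.Plane d) {lam : ℝ} (hlam : 0 ≤ lam)
    (hlip : ∀ (x : Site d) (μ : Fin d), |‖curl W Z (x + e μ, π)‖ - ‖curl W Z (x, π)‖| ≤ lam) (x₀ : Site d) {r : ℕ}
    (hr : r + 1 ≤ P) :
    ‖curl W Z (x₀, π)‖ ≤ 2 * d * r * lam + energyNormW L k W Z (periodBox (d := d) P) / Real.sqrt (((r : ℝ) + 1) ^ d) := by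
  have hx₀ : x₀ ∈ Finset.Icc x₀ (x₀ + fun _ => (r : ℤ)) := by
    rw [Finset.mem_Icc]; exact ⟨le_rfl, fun μ => by simp⟩
  have h1 := norm_curl_le_of_energyNormW_normLip L k W Z π hlam hlip (subset_refl _) hx₀
  have h2 := energyNormW_Icc_le_periodBox L k hP hW hZ x₀ hr
  have hpos : 0 < Real.sqrt (((r : ℝ) + 1) ^ d) := Real.sqrt_pos.mpr (by positivity)
  have h3 := div_le_div_of_nonneg_right h2 hpos.le
  linarith

end NormLip

/-! ## §2 Discrete Landau–Kolmogorov for sequences -/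

section SeqLK

variable {E : Type*} [NormedAddCommGroup E] [NormedSpace ℝ E]

omit [NormedSpace ℝ E] in
/-- The forward difference `j` steps ahead differs from the first one by at most `j·λ₂`. [folklore] -/
theorem seq_fwdDiff_shift_sub_le (g : ℕ → E) {lam2 : ℝ} (h2 : ∀ j : ℕ, ‖(g (j + 2) - g (j + 1)) - (g (j + 1) - g j)‖ ≤ lam2) :
    ∀ j : ℕ, ‖(g (j + 1) - g j) - (g 1 - g 0)‖ ≤ j * lam2
  | 0 => by simp
  | j + 1 => by
    have ih := seq_fwdDiff_shift_sub_le g h2 j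
    have hstep := h2 j
    show ‖(g (j + 2) - g (j + 1)) - (g 1 - g 0)‖ ≤ ((j + 1 : ℕ) : ℝ) * lam2
    calc ‖(g (j + 2) - g (j + 1)) - (g 1 - g 0)‖
        = ‖((g (j + 2) - g (j + 1)) - (g (j + 1) - g j)) + ((g (j + 1) - g j) - (g 1 - g 0))‖ := by congr 1; abel
      _ ≤ lam2 + j * lam2 := (norm_add_le _ _).trans (add_le_add hstep ih)
      _ = ((j + 1 : ℕ) : ℝ) * lam2 := by push_cast; ring

/-- **SEQUENCE LANDAU–KOLMOGOROV (two-term form)**: `‖g‖ ≤ M`, second differences `≤ λ₂` ⇒ `‖g 1 − g 0‖ ≤ 2M∕m + λ₂(m − 1)∕2` for every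
`m ≥ 1`. [folklore] -/
theorem seq_fwdDiff_le_of_sup_of_second (g : ℕ → E) {M lam2 : ℝ} (hM : ∀ j, ‖g j‖ ≤ M)
    (h2 : ∀ j : ℕ, ‖(g (j + 2) - g (j + 1)) - (g (j + 1) - g j)‖ ≤ lam2) {m : ℕ} (hm : 1 ≤ m) :
    ‖g 1 - g 0‖ ≤ 2 * M / m + lam2 * ((m : ℝ) - 1) / 2 := by
  set D : E := g 1 - g 0 with hD
  have htel : g m - g 0 = ∑ j ∈ Finset.range m, (g (j + 1) - g j) := (Finset.sum_range_sub g m).symm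
  have hsum : ∑ j ∈ Finset.range m, (g (j + 1) - g j) = m • D + ∑ j ∈ Finset.range m, ((g (j + 1) - g j) - D) := by
    simp only [Finset.sum_sub_distrib, Finset.sum_const, Finset.card_range]; abel
  have hkey : (m : ℕ) • D = (g m - g 0) - ∑ j ∈ Finset.range m, ((g (j + 1) - g j) - D) := by
    rw [htel, hsum]; abel
  have hn1 : ‖g m - g 0‖ ≤ 2 * M := by
    calc ‖g m - g 0‖ ≤ ‖g m‖ + ‖g 0‖ := norm_sub_le _ _
      _ ≤ M + M := add_le_add (hM _) (hM _)
      _ = 2 * M := by ring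
  have hn2 : ‖∑ j ∈ Finset.range m, ((g (j + 1) - g j) - D)‖ ≤ lam2 * ((m : ℝ) * ((m : ℝ) - 1) / 2) := by
    calc ‖∑ j ∈ Finset.range m, ((g (j + 1) - g j) - D)‖
        ≤ ∑ j ∈ Finset.range m, ‖(g (j + 1) - g j) - D‖ := norm_sum_le _ _
      _ ≤ ∑ j ∈ Finset.range m, (j : ℝ) * lam2 := Finset.sum_le_sum fun j _ => seq_fwdDiff_shift_sub_le g h2 j
      _ = lam2 * ∑ j ∈ Finset.range m, (j : ℝ) := by rw [Finset.mul_sum]; exact Finset.sum_congr rfl fun j _ => by ring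
      _ = lam2 * ((m : ℝ) * ((m : ℝ) - 1) / 2) := by rw [B4Block227.sum_range_id_real]
  have hmpos : (0 : ℝ) < m := by exact_mod_cast hm
  have hnorm : (m : ℝ) * ‖D‖ ≤ 2 * M + lam2 * ((m : ℝ) * ((m : ℝ) - 1) / 2) := by
    have : ‖(m : ℕ) • D‖ = (m : ℝ) * ‖D‖ := by
      rw [← Nat.cast_smul_eq_nsmul ℝ, norm_smul, Real.norm_natCast]
    rw [← this, hkey]
    exact (norm_sub_le _ _).trans (add_le_add hn1 hn2)
  have : ‖D‖ ≤ (2 * M + lam2 * ((m : ℝ) * ((m : ℝ) - 1) / 2)) / m := by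
    rw [le_div_iff₀ hmpos]; linarith
  calc ‖g 1 - g 0‖ = ‖D‖ := rfl
    _ ≤ (2 * M + lam2 * ((m : ℝ) * ((m : ℝ) - 1) / 2)) / m := this
    _ = 2 * M / m + lam2 * ((m : ℝ) - 1) / 2 := by field_simp

/-- **SEQUENCE LANDAU–KOLMOGOROV, OPTIMISED**: `‖g‖ ≤ M`, second differences `≤ λ₂`, `M, λ₂ > 0` ⇒ `‖g 1 − g 0‖ ≤ 2√(Mλ₂)`. [folklore] -/
theorem seq_fwdDiff_le_two_sqrt (g : ℕ → E) {M lam2 : ℝ} (hM0 : 0 < M) (hl0 : 0 < lam2) (hM : ∀ j, ‖g j‖ ≤ M)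
    (h2 : ∀ j : ℕ, ‖(g (j + 2) - g (j + 1)) - (g (j + 1) - g j)‖ ≤ lam2) : ‖g 1 - g 0‖ ≤ 2 * Real.sqrt (M * lam2) := by
  set θ : ℝ := 2 * Real.sqrt (M / lam2) with hθ
  have hs : Real.sqrt (M * lam2) = Real.sqrt (M / lam2) * lam2 := by
    rw [show M * lam2 = (M / lam2) * lam2 ^ 2 by field_simp, Real.sqrt_mul (div_pos hM0 hl0).le, Real.sqrt_sq hl0.le]
  have hs' : M = Real.sqrt (M / lam2) * Real.sqrt (M / lam2) * lam2 := by
    rw [← Real.sqrt_mul (div_pos hM0 hl0).le, Real.sqrt_mul_self (div_pos hM0 hl0).le]; field_simp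
  by_cases hθ1 : 1 ≤ θ
  · set m : ℕ := ⌈θ⌉₊ with hm
    have hm1 : 1 ≤ m := Nat.one_le_iff_ne_zero.mpr (Nat.pos_iff_ne_zero.mp (Nat.ceil_pos.mpr (by linarith)))
    have hmge : θ ≤ (m : ℝ) := Nat.le_ceil θ
    have hmlt : (m : ℝ) < θ + 1 := Nat.ceil_lt_add_one (by linarith)
    have h := seq_fwdDiff_le_of_sup_of_second g hM h2 hm1
    have hmpos : (0 : ℝ) < m := by exact_mod_cast hm1
    have h1 : 2 * M / m ≤ Real.sqrt (M * lam2) := by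
      rw [div_le_iff₀ hmpos, hs]
      have : 2 * M = Real.sqrt (M / lam2) * lam2 * θ := by rw [hθ]; nth_rewrite 1 [hs']; ring
      rw [this]
      exact mul_le_mul_of_nonneg_left hmge (by positivity)
    have h2' : lam2 * ((m : ℝ) - 1) / 2 ≤ Real.sqrt (M * lam2) := by
      rw [hs]
      have : lam2 * ((m : ℝ) - 1) ≤ lam2 * θ := mul_le_mul_of_nonneg_left (by linarith) hl0.le
      rw [hθ] at this
      linarith
    linarith
  · push Not at hθ1
    have h := seq_fwdDiff_le_of_sup_of_second g hM h2 (le_refl 1)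
    simp only [Nat.cast_one, div_one, sub_self, mul_zero, zero_div, add_zero] at h
    have e2 : 2 * M = θ * Real.sqrt (M * lam2) := by rw [hθ, hs]; nth_rewrite 1 [hs']; ring
    have hpos : 0 ≤ Real.sqrt (M * lam2) := Real.sqrt_nonneg _
    have : 2 * M ≤ 2 * Real.sqrt (M * lam2) := by rw [e2]; nlinarith
    linarith

end SeqLK

/-! ## §3 Parallel transport along a lattice line; the covariant Landau–Kolmogorov step -/

section Transport

variable {d : ℕ} {n : Type*} [Fintype n] [DecidableEq n]

/-- The line holonomy one step further: `H (j+1) = H j · W (b + j•e μ) μ`. [folklore] -/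
theorem lineHol_succ (W : Site d → Fin d → (Matrix n n ℂ)ˣ) (b : Site d) (μ : Fin d) (j : ℕ) :
    ((List.range (j + 1)).map fun i : ℕ => W (b + i • e μ) μ).prod
      = ((List.range j).map fun i : ℕ => W (b + i • e μ) μ).prod * W (b + j • e μ) μ := by
  rw [List.range_succ, List.map_append, List.prod_append, List.map_singleton, List.prod_singleton]

/-- The line holonomy of a unitary configuration is unitary. [folklore] -/
theorem lineHol_mem_unitary {W : Site d → Fin d → (Matrix n n ℂ)ˣ} (hW : IsUnitaryCfg W) (b : Site d) (μ : Fin d) :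
    ∀ j : ℕ, ((List.range j).map fun i : ℕ => W (b + i • e μ) μ).prod ∈ unitaryUnits (Matrix n n ℂ)
  | 0 => by rw [List.range_zero, List.map_nil, List.prod_nil]; exact (unitaryUnits (Matrix n n ℂ)).one_mem
  | j + 1 => by
    rw [lineHol_succ]
    exact (unitaryUnits (Matrix n n ℂ)).mul_mem (lineHol_mem_unitary hW b μ j) (hW _ _)

/-- **THE COVARIANT LANDAU–KOLMOGOROV STEP.**  `W` unitary; `‖Z y κ‖ ≤ M` for all `y`; the COVARIANT second differences of the
`κ`-component along `μ` are `≤ λ₂` everywhere: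
`‖Ad (W (y + e κ) μ) (Ad (W (y + e κ + e μ) μ) (Z (y + 2•e μ) κ) − Z (y + e μ) κ) − (Ad (W (y + e κ) μ) (Z (y + e μ) κ) − Z y κ)‖ ≤ λ₂`
(`Z x κ` sits at the END of its bond under the right variation `W e^Z`, so it is transported along the `μ`-line through `x + e κ`);
`M, λ₂ > 0`.  Then the covariant first difference obeys `‖Ad (W (x + e κ) μ) (Z (x + e μ) κ) − Z x κ‖ ≤ 2√(Mλ₂)` at every `x`.
Proof: transport `Z (x + j•e μ) κ` back to the base with the line holonomy `H j`; the transported sequence has norms `= ‖Z‖`, forward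
differences `= Ad (H j)`(covariant differences), second differences `= Ad (H j)`(covariant second differences); apply §2. [folklore] -/
theorem norm_covDiff_le_two_sqrt {W : Site d → Fin d → (Matrix n n ℂ)ˣ} (hW : IsUnitaryCfg W)
    {Z : Site d → Fin d → Matrix n n ℂ} (κ μ : Fin d) {M lam2 : ℝ} (hM0 : 0 < M) (hl0 : 0 < lam2) (hM : ∀ y, ‖Z y κ‖ ≤ M)
    (h2 : ∀ y : Site d, ‖Ad (W (y + e κ) μ) (Ad (W (y + e κ + e μ) μ) (Z (y + (2 : ℕ) • e μ) κ) - Z (y + e μ) κ)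
        - (Ad (W (y + e κ) μ) (Z (y + e μ) κ) - Z y κ)‖ ≤ lam2) (x : Site d) :
    ‖Ad (W (x + e κ) μ) (Z (x + e μ) κ) - Z x κ‖ ≤ 2 * Real.sqrt (M * lam2) := by
  -- the line through the base b = x + e κ, the transported sequence g
  set b : Site d := x + e κ with hb
  set H : ℕ → (Matrix n n ℂ)ˣ := fun j => ((List.range j).map fun i : ℕ => W (b + i • e μ) μ).prod with hH
  have hH0 : H 0 = 1 := by simp [hH]
  have hHs : ∀ j, H (j + 1) = H j * W (b + j • e μ) μ := fun j => lineHol_succ W b μ j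
  have hHu : ∀ j, H j ∈ unitaryUnits (Matrix n n ℂ) := fun j => lineHol_mem_unitary hW b μ j
  set g : ℕ → Matrix n n ℂ := fun j => Ad (H j) (Z (x + j • e μ) κ) with hg
  -- site bookkeeping
  have eb : ∀ j : ℕ, x + j • e μ + e κ = b + j • e μ := fun j => by rw [hb]; abel
  have es : ∀ j : ℕ, x + j • e μ + e μ = x + (j + 1) • e μ := fun j => by rw [add_assoc, ← succ_nsmul]
  have es2 : ∀ j : ℕ, x + j • e μ + (2 : ℕ) • e μ = x + (j + 2) • e μ := fun j => by rw [add_assoc, ← add_nsmul]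
  have ebs : ∀ j : ℕ, b + j • e μ + e μ = b + (j + 1) • e μ := fun j => by rw [add_assoc, ← succ_nsmul]
  -- forward differences of g are transported covariant differences
  have hdiff : ∀ j : ℕ, g (j + 1) - g j = Ad (H j) (Ad (W (b + j • e μ) μ) (Z (x + (j + 1) • e μ) κ) - Z (x + j • e μ) κ) := by
    intro j
    simp only [hg]
    rw [hHs, Ad_mul, Ad_sub]
  have hdiff2 : ∀ j : ℕ, (g (j + 2) - g (j + 1)) - (g (j + 1) - g j)
      = Ad (H j) (Ad (W (b + j • e μ) μ) (Ad (W (b + (j + 1) • e μ) μ) (Z (x + (j + 2) • e μ) κ) - Z (x + (j + 1) • e μ) κ)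
          - (Ad (W (b + j • e μ) μ) (Z (x + (j + 1) • e μ) κ) - Z (x + j • e μ) κ)) := by
    intro j
    rw [hdiff j, show j + 2 = (j + 1) + 1 by ring, hdiff (j + 1), hHs j, Ad_mul, ← Ad_sub]
  -- norms
  have hgn : ∀ j, ‖g j‖ ≤ M := fun j => by
    simp only [hg]; rw [norm_Ad_of_unitary (hHu j)]; exact hM _
  have hg2 : ∀ j : ℕ, ‖(g (j + 2) - g (j + 1)) - (g (j + 1) - g j)‖ ≤ lam2 := by
    intro j
    rw [hdiff2 j, norm_Ad_of_unitary (hHu j)]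
    have h := h2 (x + j • e μ)
    rw [eb j, ebs j, es j, es2 j] at h
    exact h
  have h := seq_fwdDiff_le_two_sqrt g hM0 hl0 hgn hg2
  have e1 : g 1 - g 0 = Ad (W (x + e κ) μ) (Z (x + e μ) κ) - Z x κ := by
    rw [show (1 : ℕ) = 0 + 1 by rfl, hdiff 0, hH0, Ad_one]
    simp [hb]
  rw [e1] at h
  exact h

end Transport

end

end Summit.QuantumFields.BalabanUV.T4Continuum.NE7EtaCovariantJunction
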